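import Literature.NumberTheory.Automorphic.UnramifiedHeckeScalarsFlathProofs
import HarnessLib

/-!
# lang.S23 (`ℓ ∤ n`) from Arthur–Clozel's base-change theorem alone (proof)

Trunk `AutomorphicAxiomatic` (G19), topic `NumberTheory/Automorphic`; second sibling proof file
of `Sweep1` for the named fact `Literature.NumberTheory.Automorphic.exists_cuspidal_baseChange_of_not_dvd` (**lang.S23**;
Arthur–Clozel, *Simple algebras, base change, and the advanced theory of the trace formula*,
Ann. of Math. Stud. 120 (1989), Ch. 3, Thm. 4.2 (a)), closing its decomposition:

* `Sweep1Proofs` proved the assembly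
  `exists_cuspidal_baseChange_of_not_dvd_of_weakLift : AC ∧ F2(F) ∧ F2(E) → lang.S23` from
  `AC = ArthurClozel1989_exists_cuspidal_weakLift_or_dvd` (Thm. 4.2 (a)–(b) as printed,
  projected onto the tree's notions: a cuspidal weak base-change lift exists, or `ℓ ∣ n`) and
  `F2 = exists_hasSatakeParameterAt_cofinite` (cuspidal representations of `GL_n` have Satake
  parameters at almost all places);
* `F2` is now a theorem: `exists_hasSatakeParameterAt_cofinite_holds` of
  `UnramifiedHeckeScalarsFlathProofs` (Gelfand pair + Schur argument for the scalar action of the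
  unramified Hecke operators, `Flath1979_heckeOperatorAt_ofLocal_eq_smul_holds`), through the
  reduction `F2 ⇐ Flath1979_heckeOperatorAt_ofLocal_eq_smul ∧
  exists_fixedVectors_principalCongruenceLevel_ne_bot` of `UnramifiedHeckeScalars` and the level
  theorem of `UnramifiedHeckeScalarsProofs` (see also the generic Gelfand-pair files
  `HilbertRepSchur`, `CartanDecompositionGLn`, `HeckeGelfandTrick`).

Hence (`exists_cuspidal_baseChange_of_not_dvd_of_arthurClozel`) **lang.S23 follows from the
single named fact `ArthurClozel1989_exists_cuspidal_weakLift_or_dvd`** — the printed theorem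
whose proof is the twisted trace formula comparison of op. cit. Ch. 2, (17.8) with Ch. 3,
§§2–4 — everything else being proved; and with strong multiplicity one over `E`
(`strong_multiplicity_one_gl`, the "(2.4)" of op. cit. p. 176) the cuspidal weak lift is unique
(`existsUnique_cuspidal_weakLift_of_not_dvd'`, from `UnramifiedHeckeLevel`).

Conversely (`arthurClozel1989_exists_cuspidal_weakLift_or_dvd_of_baseChange`), lang.S23 gives the
named fact back: the cuspidal `Π` it provides, with relation (1.1) read at ONE pair of non-zero
levels almost everywhere, is a weak base-change lift in the sense of Def. 1.1 (relation (1.1) at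
ALL pairs of levels, `IsWeakBaseChangeLift`) by `isWeakBaseChangeLift_of_eventually_exists` of
`UnramifiedHeckeLevel` (Satake parameters of cuspidal representations are level-free), whose Flath
inputs are the theorem `Flath1979_heckeOperatorAt_ofLocal_eq_smul_holds`. Hence
`exists_cuspidal_baseChange_of_not_dvd_iff_exists_cuspidal_weakLift_or_dvd`: **lang.S23 (`ℓ ∤ n`)
and `ArthurClozel1989_exists_cuspidal_weakLift_or_dvd` are equivalent** — the trust base of
lang.S23 is exactly this one rendering of op. cit. Thm. 4.2 (a)–(b), no weaker fact can discharge
it, and its residual content is the printed proof of Thm. 4.2 (the comparison of the discrete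
parts of the trace formula for `GL_n(𝔸_F)` with the `σ`-twisted one for `GL_n(𝔸_E)`, op. cit.
Ch. 2, (17.8), and Ch. 3, §§2–4).

## References

* J. Arthur, L. Clozel, Ann. of Math. Stud. 120 (1989), Ch. 3, Def. 1.1, Thm. 4.2
  [ArthurClozelAMS120].
-/

noncomputable section

open NumberField IsDedekindDomain MeasureTheory
open Literature.NumberTheory.Automorphic

namespace Literature.NumberTheory.Automorphic

variable {n : ℕ} {F E : Type} [Field F] [NumberField F] [Field E] [NumberField E] [Algebra F E]

/-- **lang.S23 (`ℓ ∤ n`) from Arthur–Clozel, Thm. 4.2 (a)–(b) alone.** The named fact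
`exists_cuspidal_baseChange_of_not_dvd` (`Sweep1`) follows from the single named fact
`ArthurClozel1989_exists_cuspidal_weakLift_or_dvd` (Arthur–Clozel (1989), Ch. 3, Thm. 4.2
(a)–(b)): the assembly `exists_cuspidal_baseChange_of_not_dvd_of_weakLift` of `Sweep1Proofs`
with both Satake-parameter inputs supplied by the theorem
`exists_hasSatakeParameterAt_cofinite_holds` (over `F` and over `E`).
[cite: ArthurClozelAMS120, Ch. 3, Thm. 4.2 (a)] -/
theorem exists_cuspidal_baseChange_of_not_dvd_of_arthurClozel
    (hAC : ArthurClozel1989_exists_cuspidal_weakLift_or_dvd (n := n) (F := F) (E := E)) :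
    exists_cuspidal_baseChange_of_not_dvd (n := n) (F := F) (E := E) :=
  exists_cuspidal_baseChange_of_not_dvd_of_weakLift hAC
    (fun _ _ => exists_hasSatakeParameterAt_cofinite_holds)
    (fun _ _ => exists_hasSatakeParameterAt_cofinite_holds)

/-- **Arthur–Clozel, Thm. 4.2 (a) for `ℓ ∤ n`: existence and uniqueness of the cuspidal weak
lift, from two facts** — `ArthurClozel1989_exists_cuspidal_weakLift_or_dvd` and strong
multiplicity one over `E` (`strong_multiplicity_one_gl`, giving uniqueness "by (2.4)",
op. cit. p. 176): `existsUnique_cuspidal_weakLift_of_not_dvd` of `UnramifiedHeckeLevel` with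
its Satake-parameter inputs discharged by `exists_hasSatakeParameterAt_cofinite_holds`.
[cite: ArthurClozelAMS120, Ch. 3, Thm. 4.2 (a)] -/
theorem existsUnique_cuspidal_weakLift_of_not_dvd'
    (hAC : ArthurClozel1989_exists_cuspidal_weakLift_or_dvd (n := n) (F := F) (E := E))
    (hSMO : ∀ (ν : Measure (AdelicGroupData.gl n E).automorphicQuotient)
      [(AdelicGroupData.gl n E).IsAutomorphicMeasure ν],
      strong_multiplicity_one_gl (n := n) (K := E) (μ := ν))
    [IsGalois F E] (hℓ : (Module.finrank F E).Prime) (hn : ¬ Module.finrank F E ∣ n)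
    (μ : Measure (AdelicGroupData.gl n F).automorphicQuotient)
    [(AdelicGroupData.gl n F).IsAutomorphicMeasure μ] (P : CuspidalAutomorphicRepGL n F μ) :
    ∃ (ν : Measure (AdelicGroupData.gl n E).automorphicQuotient)
      (_ : (AdelicGroupData.gl n E).IsAutomorphicMeasure ν),
      ∃! Q : CuspidalAutomorphicRepGL n E ν, IsWeakBaseChangeLift P.1 Q.1 :=
  existsUnique_cuspidal_weakLift_of_not_dvd hAC
    (fun _ _ => exists_hasSatakeParameterAt_cofinite_holds)
    (fun _ _ => exists_hasSatakeParameterAt_cofinite_holds) hSMO hℓ hn μ P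

/-- **lang.S23 (`ℓ ∤ n`) gives back Arthur–Clozel's Thm. 4.2 (a)–(b) as rendered in the tree.**
Conversely to `exists_cuspidal_baseChange_of_not_dvd_of_arthurClozel`, the Langlands-list statement
`exists_cuspidal_baseChange_of_not_dvd` of `Sweep1` — for `E / F` Galois of prime degree `ℓ ∤ n` and
`π` cuspidal on `GL_n(𝔸_F)`, a cuspidal `Π` on `GL_n(𝔸_E)` with relation (1.1),
`t_{Π,w} = (t_{π,v})^{f(w|v)}`, read at ONE pair of non-zero levels `K(𝔫)`, `K(𝔑)` for all but
finitely many `w` — implies the dichotomy `ArthurClozel1989_exists_cuspidal_weakLift_or_dvd` of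
`Sweep1Proofs` (a cuspidal weak base-change lift in the sense of Arthur–Clozel's Def. 1.1, i.e.
relation (1.1) at ALL pairs of levels, `IsWeakBaseChangeLift`; or `ℓ ∣ n`): if `ℓ ∣ n` there is
nothing to show, and for `ℓ ∤ n` the `Π` provided is a weak base-change lift of `π` by
`isWeakBaseChangeLift_of_eventually_exists` (`UnramifiedHeckeLevel`: one pair of levels suffices
for cuspidal representations, their Satake parameters being independent of level, uniformizer and
eigenvector), fed with the theorem `Flath1979_heckeOperatorAt_ofLocal_eq_smul_holds` over `F` and
over `E`. [cite: ArthurClozelAMS120, Ch. 3, §1 Def. 1.1 and Thm. 4.2 (a)] -/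
theorem arthurClozel1989_exists_cuspidal_weakLift_or_dvd_of_baseChange
    (h : exists_cuspidal_baseChange_of_not_dvd (n := n) (F := F) (E := E)) :
    ArthurClozel1989_exists_cuspidal_weakLift_or_dvd (n := n) (F := F) (E := E) := by
  intro _ hℓ μ _ P
  by_cases hn : Module.finrank F E ∣ n
  · exact Or.inr hn
  obtain ⟨ν, hν, Q, 𝔫, h𝔫, 𝔑, h𝔑, hw⟩ := h hℓ hn μ P
  exact Or.inl ⟨ν, hν, Q, isWeakBaseChangeLift_of_eventually_exists
    Flath1979_heckeOperatorAt_ofLocal_eq_smul_holds Flath1979_heckeOperatorAt_ofLocal_eq_smul_holds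
    P Q h𝔫 h𝔑 (hw.mono fun _ hw' => hw'.2.2)⟩

/-- **lang.S23 (`ℓ ∤ n`) is equivalent to the tree's rendering of Arthur–Clozel, Ch. 3,
Thm. 4.2 (a)–(b).** The named fact `exists_cuspidal_baseChange_of_not_dvd` (`Sweep1`) holds if and
only if the named fact `ArthurClozel1989_exists_cuspidal_weakLift_or_dvd` (`Sweep1Proofs`: every
cuspidal `π` on `GL_n(𝔸_F)` has a cuspidal weak base-change lift to `GL_n(𝔸_E)`, or `ℓ ∣ n`)
does: `exists_cuspidal_baseChange_of_not_dvd_of_arthurClozel` and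
`arthurClozel1989_exists_cuspidal_weakLift_or_dvd_of_baseChange`. So the trust base of lang.S23
is exactly this one fact, whose content is the printed proof of Thm. 4.2 (twisted trace formula
comparison, op. cit. Ch. 2, (17.8), with Ch. 3, §§2–4); all level/Satake bookkeeping between the
two formulations is proved. [cite: ArthurClozelAMS120, Ch. 3, Thm. 4.2 (a)–(b)] -/
theorem exists_cuspidal_baseChange_of_not_dvd_iff_exists_cuspidal_weakLift_or_dvd :
    exists_cuspidal_baseChange_of_not_dvd (n := n) (F := F) (E := E) ↔
      ArthurClozel1989_exists_cuspidal_weakLift_or_dvd (n := n) (F := F) (E := E) :=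
  ⟨arthurClozel1989_exists_cuspidal_weakLift_or_dvd_of_baseChange,
    exists_cuspidal_baseChange_of_not_dvd_of_arthurClozel⟩

end Literature.NumberTheory.Automorphic
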